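import Summits.AtomisticToContinuum.Crystallization.Theorems.PalmUnimodularRigidityMinimiserShellsSepQualShellNoBoundaryOfSepPeriodicShellGap
import Summits.AtomisticToContinuum.Crystallization.Theorems.PalmUnimodularRigidityMinimiserShellsNecessityBlocks
import Summits.AtomisticToContinuum.Crystallization.Theorems.PalmUnimodularRigidityMinimiserShellsResidualDefs

/-!
# The loosened hard-core periodic shell gap gives the loosened hard-core finite no-boundary gap (stub 3, r5)

Stub `stub_sepQualLooseGap` (stub 3) of line `elastic-coarse-to-fine` (reshape r5) of crux `MinimiserShells`
(stmt-AtomisticToContinuum-9225, route `PalmUnimodularRigidity`).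

This is the `θ`-LOOSENED version of stub S16
(`SepPeriodicShellGap.stub_sepQualShellNoBoundary_of_sepPeriodicShellGap`, file
`PalmUnimodularRigidityMinimiserShellsSepQualShellNoBoundaryOfSepPeriodicShellGap`): the crux's shell
predicate `GoodShell` is replaced by the loosened predicate `Residual.LooseGoodShell θ` (matching tolerance
`a/100 + θ`, shell radius `(5/4 − θ)·a`), `θ ≥ 0`.  If `Residual.ShellGap θ` holds — for every threshold
`t > 0` some `κ > 0` such that every periodic configuration `Q` of `ℝ³` with `1/3`-separated point set and
at least `t · #motif` motif sites `θ`-loosely badly shelled in `Q.points` has `e* + κ ≤ e(Q)` — then, with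
the same `κ` for each `t`, every finite injective `1/3`-separated `y : Fin N → ℝ³` with at least `t · N`
indices `θ`-loosely badly shelled in `range y` has `N · (e* + κ) ≤ 𝓔_N(y)`.

Proof (verbatim the proof of S16 at the loosened predicate).  `N = 0` is `0 ≤ 0`.  For `N ≥ 1`
periodise `y` with the cubic lattice of period `2Σ‖yᵢ‖ + 2` (`ChargedEnergyGapNegative.periodise`); the
periodisation is again `1/3`-separated (`SepPeriodicShellGap.third_le_dist_of_mem_points_periodise`).
The loosened predicate is LOCAL for `θ ≥ 0` — it reads only atoms of norm `≤ (5/4 − θ)·a ≤ 5/4`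
(`NecessityBlocks.looseGood_congr_of_local`) — and the points of the periodisation within `3/2` of a
motif site `yᵢ` are among the `yⱼ` (`PeriodicShellGap.points_periodise_inter_closedBall_subset_range`), so
the motif site `yᵢ` is `θ`-loosely badly shelled in the infinite periodic point set iff index `i` is
`θ`-loosely badly shelled in `y` (`looseGoodShell_periodise_iff`, via
`NecessityBlocks.congr_count_restrict_image_sub_of_local`).  Hence the loosely-bad indices inject into the
loosely-bad motif sites, `#bad motif ≥ #bad(y) ≥ t · N = t · #motif`
(`natCard_looseBad_le_looseBadMotifCount_periodise`), and `e* + κ ≤ e(Q) ≤ 𝓔_N(y) / N`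
(`ChargedEnergyGapNegative.energyPerParticle_periodise_le`).
-/

noncomputable section

open MeasureTheory
open scoped ENNReal BigOperators Classical

namespace Summit.AtomisticToContinuum.Crystallization.Theorems.PalmUnimodularRigidityMinimiserShells.SepQualLooseGap

open Literature.MathematicalPhysics.StatisticalMechanics (lennardJones interactionEnergy PeriodicConfiguration)
open Summit.AtomisticToContinuum.Crystallization.Theorems.MinimiserShells.Negative.LoadBearing (eStar GoodShell)
open Summit.AtomisticToContinuum.Crystallization.Theorems.MinimiserShells.Negative.Rootedness (E3)
open Summit.AtomisticToContinuum.Crystallization.Theorems.PalmUnimodularRigidityMinimiserShells.Residual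
  (ShellGap LooseGoodShell looseBadMotifCount rerooted IsSepThird)
open Summit.AtomisticToContinuum.Crystallization.Theorems.ChargedEnergyGapNegative
  (periodise periodUnit motif_periodise energyPerParticle_periodise_le)
open Summit.AtomisticToContinuum.Crystallization.Theorems.PalmUnimodularRigidityMinimiserShells.PeriodicShellGap
  (mem_motif_periodise range_subset_points_periodise points_periodise_inter_closedBall_subset_range)
open Summit.AtomisticToContinuum.Crystallization.Theorems.PalmUnimodularRigidityMinimiserShells.SepPeriodicShellGap
  (third_le_dist_of_mem_points_periodise)
open Summit.AtomisticToContinuum.Crystallization.Theorems.PalmUnimodularRigidityMinimiserShells.NecessityBlocks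
  (congr_count_restrict_image_sub_of_local looseGood_congr_of_local)

variable {N : ℕ}

/-! ## Loosened shells of the motif sites of the periodisation -/

/-- **Loosened motif shells read in the periodic point set are the loosened shells of `y`.**  For
`θ ≥ 0`, the motif site `yᵢ` is `θ`-loosely well shelled in the infinite point set of the periodisation
`y + (2Σ‖yᵢ‖ + 2)ℤ³` iff index `i` is `θ`-loosely well shelled in the finite configuration `y` (locality
of `LooseGoodShell θ`, `NecessityBlocks.congr_count_restrict_image_sub_of_local` with `R₀ = 3/2`, the
points of the periodisation within `3/2` of `yᵢ` being among the `yⱼ`). -/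
theorem looseGoodShell_periodise_iff {θ : ℝ} (hθ : 0 ≤ θ) (y : Fin N → E3) (hN : 0 < N) (i : Fin N) :
    LooseGoodShell θ ((Measure.count : Measure E3).restrict
        ((fun z => z - y i) '' (periodise y (periodUnit y) le_rfl hN).points)) ↔
      LooseGoodShell θ ((Measure.count : Measure E3).restrict ((fun z => z - y i) '' Set.range y)) :=
  congr_count_restrict_image_sub_of_local (G := LooseGoodShell θ)
    (fun hμν => looseGood_congr_of_local hθ hμν) (range_subset_points_periodise y hN)
    (by norm_num : (5 : ℝ) / 4 ≤ 3 / 2) (points_periodise_inter_closedBall_subset_range y hN i)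

/-- **Loosely-bad indices inject into loosely-bad motif sites.**  For `θ ≥ 0` and injective `y`
(`N ≥ 1` points), the number of indices `i` that are `θ`-loosely badly shelled in `y` is at most the
number `looseBadMotifCount θ Q` of motif sites of the periodisation `Q` that are `θ`-loosely badly shelled
in its infinite point set (`i ↦ yᵢ`, `looseGoodShell_periodise_iff`). -/
theorem natCard_looseBad_le_looseBadMotifCount_periodise {θ : ℝ} (hθ : 0 ≤ θ) {y : Fin N → E3}
    (hy : Function.Injective y) (hN : 0 < N) :
    Nat.card {i : Fin N // ¬ LooseGoodShell θ
        ((Measure.count : Measure E3).restrict ((fun z => z - y i) '' Set.range y))} ≤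
      looseBadMotifCount θ (periodise y (periodUnit y) le_rfl hN) := by
  unfold looseBadMotifCount rerooted
  refine Nat.card_le_card_of_injective
    (fun i => (⟨⟨y i.1, mem_motif_periodise y hN i.1⟩,
      fun h => i.2 ((looseGoodShell_periodise_iff hθ y hN i.1).1 h)⟩ :
        {x : (periodise y (periodUnit y) le_rfl hN).motif // ¬ LooseGoodShell θ
          ((Measure.count : Measure E3).restrict
            ((fun z => z - (x : E3)) '' (periodise y (periodUnit y) le_rfl hN).points))})) ?_
  intro a b hab
  have h : y a.1 = y b.1 :=
    congrArg (fun z : {x : (periodise y (periodUnit y) le_rfl hN).motif // ¬ LooseGoodShell θ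
        ((Measure.count : Measure E3).restrict
          ((fun z => z - (x : E3)) '' (periodise y (periodUnit y) le_rfl hN).points))} =>
      ((z.1 : (periodise y (periodUnit y) le_rfl hN).motif) : E3)) hab
  exact Subtype.ext (hy h)

/-! ## The stub -/

/-- **Stub `stub_sepQualLooseGap` (stub 3) of line `elastic-coarse-to-fine` (r5).**  For `θ ≥ 0`, the
`θ`-loosened hard-core periodic shell gap `ShellGap θ` (`1/3`-separated periodic configurations with at
least `t · #motif` motif sites `θ`-loosely badly shelled in `Q.points` have `e* + κ ≤ e(Q)`) implies the
`θ`-loosened hard-core finite no-boundary gap (finite injective `1/3`-separated configurations with at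
least `t · N` indices `θ`-loosely badly shelled in `range y` have `N · (e* + κ) ≤ 𝓔_N`), with the same
`κ` for each `t`: periodise `y` with the cubic lattice of period `2Σ‖yᵢ‖ + 2`; the periodisation is again
`1/3`-separated (`SepPeriodicShellGap.third_le_dist_of_mem_points_periodise`); loosened motif shells read
in the periodic point set are the loosened shells of `y`, so `#bad motif ≥ #bad(y) ≥ t · N = t · #motif`
(`natCard_looseBad_le_looseBadMotifCount_periodise`); and `e(Q) ≤ 𝓔_N(y) / N`
(`ChargedEnergyGapNegative.energyPerParticle_periodise_le`). -/
theorem stub_sepQualLooseGap :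
    ∀ θ : ℝ, 0 ≤ θ → ShellGap θ →
      ∀ t : ℝ, 0 < t → ∃ κ : ℝ, 0 < κ ∧
        ∀ (N : ℕ) (y : Fin N → EuclideanSpace ℝ (Fin 3)), Function.Injective y →
          (∀ i j : Fin N, i ≠ j → (1 : ℝ) / 3 ≤ dist (y i) (y j)) →
          t * (N : ℝ) ≤ (Nat.card {i : Fin N // ¬ LooseGoodShell θ
              ((Measure.count : Measure (EuclideanSpace ℝ (Fin 3))).restrict
                ((fun z => z - y i) '' Set.range y))} : ℝ) →
          (N : ℝ) * (eStar + κ) ≤ interactionEnergy lennardJones y := by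
  intro θ hθ hgap t ht
  obtain ⟨κ, hκ, hQ⟩ := hgap t ht
  refine ⟨κ, hκ, fun N y hy hsep hbad => ?_⟩
  rcases Nat.eq_zero_or_pos N with rfl | hN
  · simp [interactionEnergy]
  · set Q := periodise y (periodUnit y) le_rfl hN with hQdef
    have hcard : Q.motif.card = N := by
      rw [hQdef, motif_periodise, Finset.card_image_of_injective _ hy, Finset.card_univ,
        Fintype.card_fin]
    have hle : Nat.card {i : Fin N // ¬ LooseGoodShell θ
        ((Measure.count : Measure E3).restrict ((fun z => z - y i) '' Set.range y))} ≤
        looseBadMotifCount θ Q :=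
      natCard_looseBad_le_looseBadMotifCount_periodise hθ hy hN
    have hthr : t * (Q.motif.card : ℝ) ≤ (looseBadMotifCount θ Q : ℝ) := by
      rw [hcard]
      exact hbad.trans (by exact_mod_cast hle)
    have hQsep : IsSepThird Q := third_le_dist_of_mem_points_periodise hN hsep
    have h1 : eStar + κ ≤ Q.energyPerParticle lennardJones := hQ Q hQsep hthr
    have h2 : Q.energyPerParticle lennardJones ≤ interactionEnergy lennardJones y / N :=
      energyPerParticle_periodise_le hy (periodUnit y) le_rfl hN
    have hNr : (0 : ℝ) < N := by exact_mod_cast hN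
    have h3 := h1.trans h2
    rwa [le_div_iff₀ hNr, mul_comm] at h3

end Summit.AtomisticToContinuum.Crystallization.Theorems.PalmUnimodularRigidityMinimiserShells.SepQualLooseGap

end
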